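import Summits.CriticalPhenomena.PercolationContinuityZ3.Theorems.PercNearOneGluingAdditiveGluingAL5TwoRelaysTools
import Summits.CriticalPhenomena.PercolationContinuityZ3.Theorems.PercNearOneGluingAdditiveGluingKnLemma3iSigned
import HarnessLib

/-! # Crux `PercNearOneGluing.AdditiveGluing` (stmt-CriticalPhenomena-4576) — AL5 for every block and every relay set,
# part A: the QUANTITATIVE TRANSFER across one glued edge at the bystander

Support file (`--supports stmt-CriticalPhenomena-4576`; task png-dp-al5, gen 2); no definitions, no named facts.
Notation of `…AL5Layers.lean`: `μ_w = prodBernoulli w`, target `b`, bystander `x`, margin `M(v) := μ_v(x ↔ b) − μ_v(d ↔ b)`,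
`N = {d ↮ x}`.  For an edge `e = s(x,y)` at `x` write `v¹ = v[e ↦ 1]` (glued) and `v⁰ = v[e ↦ 0]` (deleted).

* `al5q_transfer` — **quantitative transfer**: `μ_{v¹}(N) · M(v) ≤ μ_v(N) · M(v¹)` for EVERY weighting `v` (no hypothesis on
  `d`).  This is Kozma–Nitzan's Lemma 3(i) kept with its sign (`knLemma3i_signed`: BHK 2006 Thms 1.3/1.4 given `{d ↮ x}` for the
  increasing `C_x`-event "`e` open"), read after conditioning on `e` (= gluing); the weight of `e` enters affinely, so the
  deleted-versus-glued form `al5q_transfer_del_glue` implies the general one.  Consequence used downstream: the glued margin is at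
  least `κ · M(v)` with the TRANSFER FACTOR `κ = μ_{v¹}(N)/μ_v(N) ∈ [0,1]`.
* `al5q_real_glueStar` — gluing a set `D` of pairs is the push-forward `ω ↦ ω ∪ D` (pinning calculus of `KozmaNitzanPinning`);
  `al5q_notConn_glueStar` — after gluing the star `x–Z`, `d ↮ x` iff before `d` avoided `x` and all of `Z`.
* `al5q_factor_mono` — **the transfer factor is monotone under gluing further pairs at `x`**: for a star `Z` at `x` (glued
  weighting `v_Z`), `μ_{v¹}(N) · μ_{v_Z}(N) ≤ μ_{(v_Z)¹}(N) · μ_v(N)`.  In the deleted base world this is BHK Thm 1.3 for the two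
  DECREASING `C_d`-events `{d ↮ y}`, `{d ↮ Z}` given `{d ↮ x}` (`knLemma3i_oneCluster` on the complements).
[cite: KozmaNitzan2024, Lemma 3(i) (pp. 6–7), Lemma 5 (p. 13); VandenbergHaggstromKahn2005, Thms. 1.3–1.4 (pp. 6–7)]
-/

namespace Summit.CriticalPhenomena.PercolationContinuityZ3.Theorems

open MeasureTheory Set
open Literature.Probability.LatticeModels (prodBernoulli)
open Literature.Probability.Percolation (BondConfig openConn openGraph openEdgeCluster pinW localCylinder
  DeterminedBy determinedBy_iff)

noncomputable section
open Classical

section AL5QTransfer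

open Filter Topology Literature.Probability.LatticeModels Literature.Probability.Percolation

variable {n : ℕ}

/-- "The pair `s(x,y)` is open" (`y ≠ x`) is increasing and determined by the open edge cluster of `x`: an open non-loop pair at
`x` belongs to `C_x`. [cite: VandenbergHaggstromKahn2005, §1 p. 3] -/
theorem al5q_open_mono (x y : Fin n) (hyx : y ≠ x) :
    ∀ ω ω' : BondConfig (Fin n), ω ∈ {ω : Set (Sym2 (Fin n)) | s(x, y) ∈ ω} →
      openEdgeCluster ω x ⊆ openEdgeCluster ω' x → ω' ∈ {ω : Set (Sym2 (Fin n)) | s(x, y) ∈ ω} := by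
  intro ω ω' hω hsub
  refine openEdgeCluster_subset ω' x (hsub ?_)
  rw [mem_openEdgeCluster_iff]
  refine ⟨hω, fun h => hyx (Sym2.mk_isDiag_iff.1 h).symm, fun v hv => ?_⟩
  rcases Sym2.mem_iff.1 hv with rfl | rfl
  · exact SimpleGraph.Reachable.refl _
  · exact ((openGraph_adj ω x v).2 ⟨hω, hyx.symm⟩).reachable

/-- **Quantitative transfer, deleted versus glued.**  For every weighting `v` and pair `e = s(x,y)`, `y ≠ x`:
`μ_{v¹}(d ↮ x) · M(v⁰) ≤ μ_{v⁰}(d ↮ x) · M(v¹)` with `M(u) = μ_u(x↔b) − μ_u(d↔b)`, `v¹ = v[e ↦ 1]`, `v⁰ = v[e ↦ 0]`.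
Proof: `knLemma3i_signed` (BHK 1.3/1.4 given `{d ↮ x}`, event "`e` open") in the weighting `v[e ↦ ½]`, then the one-edge
expansions `al5_real_inter_open` / `al5_split_edge`.
[cite: KozmaNitzan2024, Lemma 3(i) (pp. 6–7); VandenbergHaggstromKahn2005, Thms. 1.3–1.4] -/
theorem al5q_transfer_del_glue (v : Sym2 (Fin n) → unitInterval) (x y d b : Fin n) (hyx : y ≠ x) :
    (prodBernoulli (fun e' : Sym2 (Fin n) => if e' = s(x, y) then 1 else v e')).real (openConn d x)ᶜ *
        ((prodBernoulli (fun e' : Sym2 (Fin n) => if e' = s(x, y) then 0 else v e')).real (openConn x b) -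
          (prodBernoulli (fun e' : Sym2 (Fin n) => if e' = s(x, y) then 0 else v e')).real (openConn d b)) ≤
      (prodBernoulli (fun e' : Sym2 (Fin n) => if e' = s(x, y) then 0 else v e')).real (openConn d x)ᶜ *
        ((prodBernoulli (fun e' : Sym2 (Fin n) => if e' = s(x, y) then 1 else v e')).real (openConn x b) -
          (prodBernoulli (fun e' : Sym2 (Fin n) => if e' = s(x, y) then 1 else v e')).real (openConn d b)) := by
  set e : Sym2 (Fin n) := s(x, y) with he
  set v1 : Sym2 (Fin n) → unitInterval := fun e' => if e' = e then 1 else v e' with hv1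
  set v0 : Sym2 (Fin n) → unitInterval := fun e' => if e' = e then 0 else v e' with hv0
  -- the half-weight world
  set h : unitInterval := ⟨(1 : ℝ) / 2, by norm_num, by norm_num⟩ with hh
  set vh : Sym2 (Fin n) → unitInterval := fun e' => if e' = e then h else v e' with hvh
  have hvhe : (vh e : ℝ) = 1 / 2 := by simp only [hvh, if_true, hh]
  have hvh1 : (fun e' : Sym2 (Fin n) => if e' = e then (1 : unitInterval) else vh e') = v1 := by
    funext e'
    by_cases he' : e' = e
    · simp only [hv1, he', if_true]
    · simp only [hv1, hvh, he', if_false]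
  have hvh0 : (fun e' : Sym2 (Fin n) => if e' = e then (0 : unitInterval) else vh e') = v0 := by
    funext e'
    by_cases he' : e' = e
    · simp only [hv0, he', if_true]
    · simp only [hv0, hvh, he', if_false]
  have key := knLemma3i_signed vh d x b {ω : Set (Sym2 (Fin n)) | e ∈ ω} (al5q_open_mono x y hyx)
  -- one-edge expansions in the half-weight world
  have hopen : ∀ A : Set (BondConfig (Fin n)),
      (prodBernoulli vh).real (A ∩ {ω : Set (Sym2 (Fin n)) | e ∈ ω}) = 1 / 2 * (prodBernoulli v1).real A := by
    intro A
    rw [al5_real_inter_open vh e (MeasurableSet.of_discrete), hvhe, hvh1]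
  have hsplit : ∀ A : Set (BondConfig (Fin n)),
      (prodBernoulli vh).real A = 1 / 2 * (prodBernoulli v1).real A + 1 / 2 * (prodBernoulli v0).real A := by
    intro A
    rw [al5_split_edge vh e A, hvhe, hvh1, hvh0]
    norm_num
  rw [hopen, hopen, hopen, hsplit, hsplit, hsplit] at key
  nlinarith [key, measureReal_nonneg (μ := prodBernoulli v1) (s := (openConn d x)ᶜ),
    measureReal_nonneg (μ := prodBernoulli v0) (s := (openConn d x)ᶜ)]

/-- **Quantitative transfer** (general weight of the glued pair): for every weighting `v` and `e = s(x,y)`, `y ≠ x`,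
`μ_{v¹}(d ↮ x) · M(v) ≤ μ_v(d ↮ x) · M(v¹)`, `v¹ = v[e ↦ 1]`, `M(u) = μ_u(x↔b) − μ_u(d↔b)`.  (The weight `t = v(e)` enters
affinely: `μ_v = t μ_{v¹} + (1−t) μ_{v⁰}`, reducing to `al5q_transfer_del_glue`.)  No comparison hypothesis between `d` and
anything is needed. [cite: KozmaNitzan2024, Lemma 3(i) (pp. 6–7); VandenbergHaggstromKahn2005, Thms. 1.3–1.4] -/
theorem al5q_transfer (v : Sym2 (Fin n) → unitInterval) (x y d b : Fin n) (hyx : y ≠ x) :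
    (prodBernoulli (fun e' : Sym2 (Fin n) => if e' = s(x, y) then 1 else v e')).real (openConn d x)ᶜ *
        ((prodBernoulli v).real (openConn x b) - (prodBernoulli v).real (openConn d b)) ≤
      (prodBernoulli v).real (openConn d x)ᶜ *
        ((prodBernoulli (fun e' : Sym2 (Fin n) => if e' = s(x, y) then 1 else v e')).real (openConn x b) -
          (prodBernoulli (fun e' : Sym2 (Fin n) => if e' = s(x, y) then 1 else v e')).real (openConn d b)) := by
  have key := al5q_transfer_del_glue v x y d b hyx
  have ht0 : 0 ≤ (v s(x, y) : ℝ) := unitInterval.nonneg _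
  have ht1 : (v s(x, y) : ℝ) ≤ 1 := unitInterval.le_one _
  rw [al5_split_edge v s(x, y) (openConn d x)ᶜ, al5_split_edge v s(x, y) (openConn x b),
    al5_split_edge v s(x, y) (openConn d b)]
  nlinarith [key, ht0, ht1,
    measureReal_nonneg (μ := prodBernoulli (fun e' : Sym2 (Fin n) => if e' = s(x, y) then 1 else v e'))
      (s := (openConn d x)ᶜ)]


/-! ### Gluing pairs is a push-forward; gluing a star at `x` and the event `{d ↮ x}` -/

/-- **Gluing a finite set `D` of pairs is the push-forward `ω ↦ ω ∪ D`**: `μ_{v[D ↦ 1]}(E) = μ_v{ω | ω ∪ D ∈ E}` (pinning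
calculus: the glued weighting is `pinW v D D`, the pinned law lives on the cylinder `[D]_D`, on which `E` agrees with the pull-back
of `E` along `overwrite D D = (· ∪ D)`, an event determined by `Dᶜ`). [cite: KozmaNitzan2024, §3.1 (gluing = probability 1), §4 p. 20] -/
theorem al5q_real_glueSet (v : Sym2 (Fin n) → unitInterval) (D : Finset (Sym2 (Fin n))) (E : Set (BondConfig (Fin n))) :
    (prodBernoulli (fun e' : Sym2 (Fin n) => if e' ∈ D then 1 else v e')).real E =
      (prodBernoulli v).real {ω : BondConfig (Fin n) | ω ∪ (↑D : Set (Sym2 (Fin n))) ∈ E} := by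
  have hpin : (fun e' : Sym2 (Fin n) => if e' ∈ D then (1 : unitInterval) else v e') =
      pinW v (↑D : Set (Sym2 (Fin n))) (↑D : Set (Sym2 (Fin n))) := by
    funext e'
    by_cases he : e' ∈ D
    · rw [if_pos he, pinW_apply_of_mem_of_mem v (Finset.mem_coe.2 he) (Finset.mem_coe.2 he)]
    · rw [if_neg he, pinW_apply_of_not_mem v _ (fun h => he (Finset.mem_coe.1 h))]
  have hov : ∀ ω : BondConfig (Fin n), overwrite (↑D : Set (Sym2 (Fin n))) ↑D ω = ω ∪ ↑D := by
    intro ω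
    ext e'
    rw [mem_overwrite_iff]
    simp only [Set.mem_union, Finset.mem_coe]
    tauto
  have hpre : overwrite (↑D : Set (Sym2 (Fin n))) ↑D ⁻¹' E = {ω : BondConfig (Fin n) | ω ∪ (↑D : Set (Sym2 (Fin n))) ∈ E} := by
    ext ω
    simp only [Set.mem_preimage, Set.mem_setOf_eq, hov ω]
  have hcount : (↑D : Set (Sym2 (Fin n))).Countable := D.finite_toSet.countable
  rw [hpin, ← prodBernoulli_pinW_real_inter_localCylinder v hcount ↑D E,
    inter_localCylinder_eq_preimage_overwrite_inter, prodBernoulli_pinW_real_inter_localCylinder v hcount ↑D,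
    prodBernoulli_real_eq_of_determinedBy (pinW v ↑D ↑D) v (F := (↑D : Set (Sym2 (Fin n)))ᶜ)
      (fun i hi => pinW_apply_of_not_mem v _ hi) (determinedBy_preimage_overwrite _ _ E) MeasurableSet.of_discrete,
    hpre]

/-- After gluing the star `x–Z` (adding the pairs `s(x,z)`, `z ∈ Z`), `d` is NOT joined to `x` iff, before, `d` was joined
neither to `x` nor to any `z ∈ Z`: a walk from `d` cannot use a glued pair without first reaching one of its endpoints.
[folklore] -/
theorem al5q_notConn_glueStar (x d : Fin n) (Z : Finset (Fin n)) (ω : BondConfig (Fin n)) :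
    ¬ (openGraph (ω ∪ (↑(Z.image fun z => s(x, z)) : Set (Sym2 (Fin n))) : BondConfig (Fin n))).Reachable d x ↔
      (¬ (openGraph ω).Reachable d x ∧ ∀ z ∈ Z, ¬ (openGraph ω).Reachable d z) := by
  set D : Set (Sym2 (Fin n)) := ↑(Z.image fun z => s(x, z)) with hD
  have hmono : ∀ {u v : Fin n}, (openGraph ω).Reachable u v → (openGraph (ω ∪ D : BondConfig (Fin n))).Reachable u v :=
    fun h => h.mono (openGraph_mono Set.subset_union_left)
  constructor
  · intro h
    refine ⟨fun hdx => h (hmono hdx), fun z hz hdz => h ?_⟩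
    rcases eq_or_ne z x with rfl | hzx
    · exact hmono hdz
    · refine (hmono hdz).trans (SimpleGraph.Adj.reachable ?_)
      rw [openGraph_adj]
      refine ⟨Set.mem_union_right _ ?_, hzx⟩
      rw [hD, Finset.coe_image]
      exact ⟨z, Finset.mem_coe.2 hz, Sym2.eq_swap⟩
  · rintro ⟨hdx, hZ⟩ h
    obtain ⟨p⟩ := h
    suffices key : ∀ (u v : Fin n) (q : (openGraph (ω ∪ D : BondConfig (Fin n))).Walk u v),
        (openGraph ω).Reachable d u → (openGraph ω).Reachable d v from hdx (key d x p (SimpleGraph.Reachable.refl _))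
    intro u v q
    induction q with
    | nil => exact id
    | cons hadj q ih =>
      intro hu
      refine ih ?_
      rename_i u' w' _
      obtain ⟨hmem, hne⟩ := (openGraph_adj _ u' w').1 hadj
      rcases hmem with hω | hglue
      · exact hu.trans ((openGraph_adj ω u' w').2 ⟨hω, hne⟩).reachable
      · exfalso
        rw [hD, Finset.coe_image] at hglue
        obtain ⟨z, hz, hzeq⟩ := hglue
        have hz' : z ∈ Z := Finset.mem_coe.1 hz
        rcases Sym2.eq_iff.1 hzeq with ⟨h1, h2⟩ | ⟨h1, h2⟩
        · exact hdx (h1 ▸ hu)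
        · exact hZ z hz' (h2 ▸ hu)

/-- Gluing the star `x–Z`: `μ_{v[x–Z ↦ 1]}(d ↮ x) = μ_v{d ↮ x and d ↮ z for all z ∈ Z}`. [folklore] -/
theorem al5q_real_notConn_glueStar (v : Sym2 (Fin n) → unitInterval) (x d : Fin n) (Z : Finset (Fin n)) :
    (prodBernoulli (fun e' : Sym2 (Fin n) => if e' ∈ Z.image (fun z => s(x, z)) then 1 else v e')).real (openConn d x)ᶜ =
      (prodBernoulli v).real {ω : BondConfig (Fin n) | ¬ (openGraph ω).Reachable d x ∧ ∀ z ∈ Z, ¬ (openGraph ω).Reachable d z} := by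
  rw [al5q_real_glueSet]
  congr 1
  ext ω
  exact al5q_notConn_glueStar x d Z ω

/-- "`d` is joined to some `z ∈ Z`" is increasing and determined by the open edge cluster of `d`.
[cite: VandenbergHaggstromKahn2005, §1 p. 3] -/
theorem al5q_biUnion_mono (d : Fin n) (Z : Finset (Fin n)) :
    ∀ ω ω' : BondConfig (Fin n), ω ∈ (⋃ z ∈ Z, openConn d z : Set (BondConfig (Fin n))) →
      openEdgeCluster ω d ⊆ openEdgeCluster ω' d → ω' ∈ (⋃ z ∈ Z, openConn d z : Set (BondConfig (Fin n))) := by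
  intro ω ω' hω hsub
  simp only [Set.mem_iUnion, exists_prop] at hω ⊢
  obtain ⟨z, hz, hdz⟩ := hω
  refine ⟨z, hz, ?_⟩
  have h := (reachable_iff_exists_mem_openEdgeCluster ω d z).1 hdz
  refine (reachable_iff_exists_mem_openEdgeCluster ω' d z).2 ?_
  rcases h with h | ⟨e, he, hze⟩
  · exact Or.inl h
  · exact Or.inr ⟨e, hsub he, hze⟩

/-- **BHK 2006 Thm 1.3 for two DECREASING `C_d`-events given `{d ↮ x}`** (`d ≠ x`): with `N = {d ↮ x}`, `A = {d ↔ y}`,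
`Q` increasing and determined by `C_d`: `μ(N ∩ Aᶜ) μ(N ∩ Qᶜ) ≤ μ(N) μ(N ∩ Aᶜ ∩ Qᶜ)` (the covariance of two complements equals the
covariance of the events; `knLemma3i_oneCluster`). [cite: VandenbergHaggstromKahn2005, Thm. 1.3 (p. 6)] -/
theorem al5q_bhk_two_decr (w : Sym2 (Fin n) → unitInterval) (d x y : Fin n) (hdx : d ≠ x) (Q : Set (BondConfig (Fin n)))
    (hQ : ∀ ω ω' : BondConfig (Fin n), ω ∈ Q → openEdgeCluster ω d ⊆ openEdgeCluster ω' d → ω' ∈ Q) :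
    (prodBernoulli w).real ((openConn d x)ᶜ ∩ (openConn d y)ᶜ) * (prodBernoulli w).real ((openConn d x)ᶜ ∩ Qᶜ) ≤
      (prodBernoulli w).real (openConn d x)ᶜ * (prodBernoulli w).real ((openConn d x)ᶜ ∩ (openConn d y)ᶜ ∩ Qᶜ) := by
  have key := knLemma3i_oneCluster w d x y Q hQ hdx
  set μ := prodBernoulli w with hμ
  set N : Set (BondConfig (Fin n)) := (openConn d x)ᶜ with hN
  set A : Set (BondConfig (Fin n)) := openConn d y with hA
  have hmA : MeasurableSet A := MeasurableSet.of_discrete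
  have hmQ : MeasurableSet Q := MeasurableSet.of_discrete
  have h1 : μ.real (N ∩ Aᶜ) = μ.real N - μ.real (N ∩ A) := by
    have := measureReal_inter_add_sdiff (μ := μ) (s := N) hmA
    rw [Set.sdiff_eq] at this
    linarith
  have h2 : μ.real (N ∩ Qᶜ) = μ.real N - μ.real (N ∩ Q) := by
    have := measureReal_inter_add_sdiff (μ := μ) (s := N) hmQ
    rw [Set.sdiff_eq] at this
    linarith
  have h3 : μ.real (N ∩ Aᶜ ∩ Qᶜ) = μ.real N - μ.real (N ∩ A) - μ.real (N ∩ Q) + μ.real (N ∩ (A ∩ Q)) := by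
    have e1 := measureReal_inter_add_sdiff (μ := μ) (s := N ∩ Aᶜ) hmQ
    have e2 := measureReal_inter_add_sdiff (μ := μ) (s := N ∩ Q) hmA
    have hset1 : (N ∩ Aᶜ) \ Q = N ∩ Aᶜ ∩ Qᶜ := by rw [Set.sdiff_eq]
    have hset2 : N ∩ Aᶜ ∩ Q = (N ∩ Q) \ A := by
      ext ω; simp only [Set.mem_inter_iff, Set.mem_compl_iff, Set.mem_sdiff]; tauto
    have hset3 : N ∩ Q ∩ A = N ∩ (A ∩ Q) := by
      ext ω; simp only [Set.mem_inter_iff]; tauto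
    rw [hset1, hset2] at e1
    rw [hset3] at e2
    linarith
  rw [h1, h2, h3]
  nlinarith [key, measureReal_nonneg (μ := μ) (s := N), measureReal_nonneg (μ := μ) (s := N ∩ A),
    measureReal_nonneg (μ := μ) (s := N ∩ Q), measureReal_nonneg (μ := μ) (s := N ∩ (A ∩ Q))]

/-- **The transfer factor is monotone under gluing further pairs at `x`.**  `v` any weighting, `e = s(x,y)` (`y ≠ x`), `Z` a set
of further neighbours (`y ∉ Z`), `v_Z = v[x–Z ↦ 1]`, `N = {d ↮ x}`, `d ≠ x`:
`μ_{v¹}(N) · μ_{v_Z}(N) ≤ μ_{(v_Z)¹}(N) · μ_v(N)`, i.e. `κ(v) = μ_{v¹}(N)/μ_v(N)` can only grow when more pairs at `x` are glued.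
Proof: the weight of `e` enters affinely; at weight `0` all four quantities live in the base world `v⁰` as the `{d ↮ x}`-restricted
probabilities of the decreasing `C_d`-events `{d ↮ y}`, `{d ↮ Z}` and their intersection (`al5q_real_notConn_glueStar`), and BHK Thm 1.3
(`al5q_bhk_two_decr`) is exactly the claim. [cite: VandenbergHaggstromKahn2005, Thm. 1.3 (p. 6); KozmaNitzan2024, §3.1] -/
theorem al5q_factor_mono (v : Sym2 (Fin n) → unitInterval) (x y d : Fin n) (Z : Finset (Fin n)) (hyx : y ≠ x) (hyZ : y ∉ Z)
    (hdx : d ≠ x) :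
    (prodBernoulli (fun e' : Sym2 (Fin n) => if e' = s(x, y) then 1 else v e')).real (openConn d x)ᶜ *
        (prodBernoulli (fun e' : Sym2 (Fin n) => if e' ∈ Z.image (fun z => s(x, z)) then 1 else v e')).real (openConn d x)ᶜ ≤
      (prodBernoulli (fun e' : Sym2 (Fin n) => if e' = s(x, y) then 1 else
          (if e' ∈ Z.image (fun z => s(x, z)) then 1 else v e'))).real (openConn d x)ᶜ *
        (prodBernoulli v).real (openConn d x)ᶜ := by
  set e : Sym2 (Fin n) := s(x, y) with he
  have heZ : e ∉ Z.image (fun z => s(x, z)) := by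
    intro h
    obtain ⟨z, hz, hze⟩ := Finset.mem_image.1 h
    rcases Sym2.eq_iff.1 hze with ⟨-, h2⟩ | ⟨h1, -⟩
    · exact hyZ (h2 ▸ hz)
    · exact hyx (h1 ▸ rfl) |>.elim
  set v1 : Sym2 (Fin n) → unitInterval := fun e' => if e' = e then 1 else v e' with hv1
  set vZ : Sym2 (Fin n) → unitInterval := fun e' => if e' ∈ Z.image (fun z => s(x, z)) then 1 else v e' with hvZ
  set vZ1 : Sym2 (Fin n) → unitInterval := fun e' => if e' = e then 1 else vZ e' with hvZ1
  set v0 : Sym2 (Fin n) → unitInterval := fun e' => if e' = e then 0 else v e' with hv0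
  set N : Set (BondConfig (Fin n)) := (openConn d x)ᶜ with hN
  -- the weight of `e` is the same in `v` and `v_Z`
  have hvZe : (vZ e : ℝ) = (v e : ℝ) := by simp only [hvZ, heZ, if_false]
  -- the deleted worlds as star-glued versions of the base `v0`
  have hglue_y : (fun e' : Sym2 (Fin n) => if e' ∈ ({y} : Finset (Fin n)).image (fun z => s(x, z)) then 1 else v0 e') = v1 := by
    funext e'
    have hmem : (e' ∈ ({y} : Finset (Fin n)).image (fun z => s(x, z))) ↔ e' = e := by
      rw [Finset.image_singleton, Finset.mem_singleton]
    by_cases h : e' = e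
    · rw [if_pos (hmem.2 h)]
      show (1 : unitInterval) = v1 e'
      simp only [hv1, h, if_true]
    · rw [if_neg (fun h' => h (hmem.1 h'))]
      show v0 e' = v1 e'
      simp only [hv1, hv0, h, if_false]
  have hglue_Z : (fun e' : Sym2 (Fin n) => if e' ∈ Z.image (fun z => s(x, z)) then 1 else v0 e') =
      fun e' : Sym2 (Fin n) => if e' = e then 0 else vZ e' := by
    funext e'
    by_cases h : e' = e
    · simp only [h, heZ, if_false, hv0, if_true]
    · simp only [hv0, hvZ, h, if_false]
  have hglue_yZ : (fun e' : Sym2 (Fin n) => if e' ∈ (insert y Z).image (fun z => s(x, z)) then 1 else v0 e') = vZ1 := by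
    funext e'
    rw [Finset.image_insert]
    by_cases h : e' = e
    · simp only [h, he, Finset.mem_insert, true_or, if_true, hvZ1]
    · have h' : e' ≠ s(x, y) := h
      simp only [Finset.mem_insert, h', false_or, hvZ1, hv0, hvZ, h, if_false]
  -- the four `t = 0` quantities in the base world
  have q_y := al5q_real_notConn_glueStar v0 x d {y}
  have q_Z := al5q_real_notConn_glueStar v0 x d Z
  have q_yZ := al5q_real_notConn_glueStar v0 x d (insert y Z)
  rw [hglue_y] at q_y
  rw [hglue_Z] at q_Z
  rw [hglue_yZ] at q_yZ
  -- identify them with `{d↮x}`-restricted events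
  set A : Set (BondConfig (Fin n)) := openConn d y with hA
  set Q : Set (BondConfig (Fin n)) := ⋃ z ∈ Z, openConn d z with hQ
  have hset_y : {ω : BondConfig (Fin n) | ¬ (openGraph ω).Reachable d x ∧ ∀ z ∈ ({y} : Finset (Fin n)), ¬ (openGraph ω).Reachable d z}
      = N ∩ Aᶜ := by
    ext ω
    simp only [Set.mem_setOf_eq, Finset.mem_singleton, forall_eq, hN, hA, Set.mem_inter_iff, Set.mem_compl_iff]
    rfl
  have hset_Z : {ω : BondConfig (Fin n) | ¬ (openGraph ω).Reachable d x ∧ ∀ z ∈ Z, ¬ (openGraph ω).Reachable d z} = N ∩ Qᶜ := by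
    ext ω
    simp only [Set.mem_setOf_eq, hN, hQ, Set.mem_inter_iff, Set.mem_compl_iff, Set.mem_iUnion, exists_prop, not_exists,
      not_and]
    rfl
  have hset_yZ : {ω : BondConfig (Fin n) | ¬ (openGraph ω).Reachable d x ∧ ∀ z ∈ insert y Z, ¬ (openGraph ω).Reachable d z}
      = N ∩ Aᶜ ∩ Qᶜ := by
    ext ω
    simp only [Set.mem_setOf_eq, Finset.mem_insert, forall_eq_or_imp, hN, hA, hQ, Set.mem_inter_iff, Set.mem_compl_iff,
      Set.mem_iUnion, exists_prop, not_exists, not_and]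
    constructor
    · rintro ⟨h1, h2, h3⟩; exact ⟨⟨h1, h2⟩, h3⟩
    · rintro ⟨⟨h1, h2⟩, h3⟩; exact ⟨h1, h2, h3⟩
  rw [hset_y] at q_y
  rw [hset_Z] at q_Z
  rw [hset_yZ] at q_yZ
  have bhk := al5q_bhk_two_decr v0 d x y hdx Q (al5q_biUnion_mono d Z)
  rw [← q_y, ← q_Z, ← q_yZ] at bhk
  -- affine reduction to `t = 0`
  have ht0 : 0 ≤ (v e : ℝ) := unitInterval.nonneg _
  have ht1 : (v e : ℝ) ≤ 1 := unitInterval.le_one _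
  have hsv := al5_split_edge v e N
  have hsZ := al5_split_edge vZ e N
  rw [hvZe] at hsZ
  have hv1' : (fun e' : Sym2 (Fin n) => if e' = e then (1 : unitInterval) else v e') = v1 := rfl
  rw [hv1'] at hsv
  rw [hsv, hsZ]
  nlinarith [bhk, ht0, ht1, measureReal_nonneg (μ := prodBernoulli v1) (s := N),
    measureReal_nonneg (μ := prodBernoulli vZ1) (s := N),
    measureReal_nonneg (μ := prodBernoulli v0) (s := N),
    measureReal_nonneg (μ := prodBernoulli (fun e' : Sym2 (Fin n) => if e' = e then 0 else vZ e')) (s := N)]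

end AL5QTransfer

end

end Summit.CriticalPhenomena.PercolationContinuityZ3.Theorems
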